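import Summits.HubbardSuperconductivity.HubbardSuperconductivity.Theorems.NoGoNogoThesis
import Summits.HubbardSuperconductivity.HubbardSuperconductivity.Theorems.DeformationLadderLowEnergyRigidityKernelStates

/-!
# Crux `MesoscopicPairOrder` (item `stmt-HubbardSuperconductivity-7331`): load-bearing hypotheses

Negative-side lemmas of the standing disprover (cdisprove cycle 1), sorry-free; workfile
`Cruxes/MesoscopicPairOrder/Disproof.lean`.  The crux (route `FunctionFieldCertificate`, pole-free
half) asks, at ONE `(U, δ)`, for a margin `m R² ≤ T_R(ψ)/L²` of the Fejér-box pair functional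
`T_R(ψ) = Σ_{x,y} Πᵢ (1 - |(y-x)ᵢ|_L/R)₊ Re⟨P_x ψ, P_y ψ⟩` (`P_x = localPair dWaveFormFactor L x`) at
arbitrarily large scales `R`, in EVERY normalised `(2⌊(1-δ)L²/2⌋, S^z = 0)`-sector ground state of
`hubbardTorus 2 L 1 U` on all large even tori.  Since the tree proves
`HubbardSuperconductivity → MesoscopicPairOrder` (`mesoscopicPairOrder_of_hubbardSuperconductivity`),
no refutation short of a disproof of the summit at every `(U, δ)` exists; this file records which
syntactic features of the crux a proof must genuinely use.  No definition is introduced: the mutated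
statements are spelled out verbatim.

* `false_without_groundState` — with "ground state in the sector" weakened to "unit vector in the
  sector" (density and `S^z` kept, minimality dropped) the statement is FALSE at every `(U, δ)`: the
  row-separated `↑/↓` occupation state of the sector (`exists_unit_localKernel_state`, the LOCAL form
  of the kernel states of `Theorems.hcf_exists_unit_kernel_state`: every `P_x`, not only `Δ_d = Σ P_x`,
  kills it) has `T_R = 0` at every scale.  Sector + density information alone carries no pair order.
* `false_without_normalisation` — without `star ψ ⬝ᵥ ψ = 1` it is FALSE (sector ground states exist
  and form a cone, `NoGo.exists_unit_groundStateInSector_hubbardTorus`, `NoGo.isGroundStateInSector_smul`;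
  `T_R(cψ) = |c|² T_R(ψ)`, `boxSum_smul`).
* `body_holds_at_scale_zero` — the `R₀ = 0` instance is vacuous: the weight at `R = 0` is the junk
  constant `1` (`x / 0 = 0`) and `T_0(ψ) = ‖Δ_d ψ‖² ≥ 0` (`boxSum_zero_eq`), so `m · 0² ≤ T_0(ψ)/L²`
  for EVERY vector; the content of the crux starts at `R₀ = 1` (where every lemma of the companion
  file `SaturatedExclusion` instantiates it).

Sources: E. H. Lieb, PRL 62 (1989) 1201 (sectors); D. J. Scalapino, Phys. Rep. 250 (1995) 329, §2
(pair field); H. Tasaki, *Physics and Mathematics of Quantum Many-Body Systems* (2020) §2.2; folklore.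
-/

noncomputable section

namespace Summit.HubbardSuperconductivity.HubbardSuperconductivity.Theorems.MesoscopicPairOrder.Negative

open Matrix Finset Filter
open Literature.Probability.LatticeModels Literature.MathematicalPhysics.QuantumLattice
open scoped ComplexOrder

/-! ### Bookkeeping -/

/-- If every local pair operator kills `ψ`, the box functional vanishes at every scale. [folklore] -/
theorem boxSum_eq_zero_of_forall_localPair_eq_zero (L : ℕ) [NeZero L] (R : ℕ)
    {ψ : Fock (Orb (FermionTorus 2 L))} (h : ∀ x : TorusSite 2 L, localPair dWaveFormFactor L x *ᵥ ψ = 0) :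
    (∑ x : TorusSite 2 L, ∑ y : TorusSite 2 L,
          (∏ i : Fin 2, max 0 (1 - |(((y i - x i).valMinAbs : ℤ) : ℝ)| / (R : ℝ))) *
            (star (localPair dWaveFormFactor L x *ᵥ ψ) ⬝ᵥ (localPair dWaveFormFactor L y *ᵥ ψ)).re) = 0 := by
  simp [h]

/-- `T_R(c ψ) = |c|² T_R(ψ)`. [folklore] -/
theorem boxSum_smul (L : ℕ) [NeZero L] (R : ℕ) (c : ℂ) (ψ : Fock (Orb (FermionTorus 2 L))) :
    (∑ x : TorusSite 2 L, ∑ y : TorusSite 2 L,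
          (∏ i : Fin 2, max 0 (1 - |(((y i - x i).valMinAbs : ℤ) : ℝ)| / (R : ℝ))) *
            (star (localPair dWaveFormFactor L x *ᵥ (c • ψ)) ⬝ᵥ (localPair dWaveFormFactor L y *ᵥ (c • ψ))).re) = ‖c‖ ^ 2 * (∑ x : TorusSite 2 L, ∑ y : TorusSite 2 L,
          (∏ i : Fin 2, max 0 (1 - |(((y i - x i).valMinAbs : ℤ) : ℝ)| / (R : ℝ))) *
            (star (localPair dWaveFormFactor L x *ᵥ ψ) ⬝ᵥ (localPair dWaveFormFactor L y *ᵥ ψ)).re) := by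
  rw [Finset.mul_sum]
  refine Finset.sum_congr rfl fun x _ => ?_
  rw [Finset.mul_sum]
  refine Finset.sum_congr rfl fun y _ => ?_
  rw [mulVec_smul, mulVec_smul, star_smul, smul_dotProduct, dotProduct_smul, smul_smul, smul_eq_mul,
    Complex.star_def, ← Complex.normSq_eq_conj_mul_self, Complex.normSq_eq_norm_sq,
    Complex.re_ofReal_mul]
  ring

/-- `Σ_x Σ_y Re⟨v_x, v_y⟩ = Re⟨Σ_x v_x, Σ_y v_y⟩`. [folklore] -/
theorem sum_sum_re_dotProduct_eq {ι n : Type*} [Fintype ι] [Fintype n] (v : ι → n → ℂ) :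
    ∑ x, ∑ y, (star (v x) ⬝ᵥ v y).re = (star (∑ x, v x) ⬝ᵥ (∑ y, v y)).re := by
  rw [star_sum, sum_dotProduct, Complex.re_sum]
  refine sum_congr rfl fun x _ => ?_
  rw [dotProduct_sum, Complex.re_sum]

/-- At `R = 0` the weight is the junk constant `1` (`x / 0 = 0`) and the box functional is the full
pair structure factor `T_0(ψ) = Re⟨Δ_d ψ, Δ_d ψ⟩ = ‖Δ_d ψ‖²`. [folklore] -/
theorem boxSum_zero_eq (L : ℕ) [NeZero L] (ψ : Fock (Orb (FermionTorus 2 L))) :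
    (∑ x : TorusSite 2 L, ∑ y : TorusSite 2 L,
          (∏ i : Fin 2, max 0 (1 - |(((y i - x i).valMinAbs : ℤ) : ℝ)| / ((0 : ℕ) : ℝ))) *
            (star (localPair dWaveFormFactor L x *ᵥ ψ) ⬝ᵥ (localPair dWaveFormFactor L y *ᵥ ψ)).re) =
      (star (pairField dWaveFormFactor L *ᵥ ψ) ⬝ᵥ (pairField dWaveFormFactor L *ᵥ ψ)).re := by
  have hw : ∀ x y : TorusSite 2 L,
      (∏ i : Fin 2, max 0 (1 - |(((y i - x i).valMinAbs : ℤ) : ℝ)| / ((0 : ℕ) : ℝ))) = 1 := by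
    intro x y; simp
  simp_rw [hw, one_mul]
  rw [sum_sum_re_dotProduct_eq, pairField, sum_mulVec]

/-! ### Explicit unit vectors of the sector killed by every local pair -/

/-- Local form of `Theorems.hcf_pairField_mulVec_single_eq_zero`: if no step `e ∈ {0, ±e₁, ±e₂}`
joins an occupied `↑` orbital at `x` to an occupied `↓` orbital at `x + e` of the occupation set
`s₀` (either order), then the local pair `P_x` kills the basis state `|s₀⟩`, for every form factor.
[folklore] -/
theorem localPair_mulVec_single_eq_zero (L : ℕ) [NeZero L] (g : Site 2 → ℝ)
    (s₀ : Finset (Orb (FermionTorus 2 L))) (x : TorusSite 2 L)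
    (h : ∀ e ∈ insert (0 : Site 2) unitSteps,
      ¬ (orb (FermionTorus.ofTorusSite x) 0 ∈ s₀ ∧
          orb (FermionTorus.ofTorusSite (x + Torus.proj L e)) 1 ∈ s₀) ∧
      ¬ (orb (FermionTorus.ofTorusSite x) 1 ∈ s₀ ∧
          orb (FermionTorus.ofTorusSite (x + Torus.proj L e)) 0 ∈ s₀)) :
    localPair g L x *ᵥ Pi.single s₀ (1 : ℂ) = 0 := by
  rw [localPair, sum_mulVec]
  refine sum_eq_zero fun e he => ?_
  rw [smul_mulVec, sub_mulVec]
  have h1 : (annihilation (orb (FermionTorus.ofTorusSite x) 0) *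
      annihilation (orb (FermionTorus.ofTorusSite (x + Torus.proj L e)) 1)) *ᵥ Pi.single s₀ (1 : ℂ) = 0 := by
    convert Theorems.hcf_annihilation_mul_annihilation_mulVec_single_eq_zero _ _ _ (h e he).1 using 3
  have h2 : (annihilation (orb (FermionTorus.ofTorusSite x) 1) *
      annihilation (orb (FermionTorus.ofTorusSite (x + Torus.proj L e)) 0)) *ᵥ Pi.single s₀ (1 : ℂ) = 0 := by
    convert Theorems.hcf_annihilation_mul_annihilation_mulVec_single_eq_zero _ _ _ (h e he).2 using 3
  rw [h1, h2, sub_zero, smul_zero]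

/-- **Explicit unit LOCAL kernel states.** For `2 ≤ L` and `2m + 3L ≤ L²` there is a unit vector of
the joint sector `(N, S^z) = (2m, 0)` killed by EVERY local `d`-wave pair operator `P_x` (not only
by their sum `Δ_d`): the occupation basis state with the `m` `↑`-electrons on the sites of rank
`< m` and the `m` `↓`-electrons on the sites of rank in `[m + 2L, 2m + 2L)` (rank `x₀ + L x₁`), two
rows apart (tree: `Theorems.hcf_rowSeparated_no_neighbours`). [folklore] -/
theorem exists_unit_localKernel_state (L : ℕ) [NeZero L] (hL : 2 ≤ L) {m : ℕ}
    (hm : 2 * m + 3 * L ≤ L ^ 2) :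
    ∃ φ : Fock (Orb (FermionTorus 2 L)), φ ∈ szSector (Λ := FermionTorus 2 L) (2 * m) 0 ∧
      star φ ⬝ᵥ φ = 1 ∧ ∀ x : TorusSite 2 L, localPair dWaveFormFactor L x *ᵥ φ = 0 := by
  set rank : FermionTorus 2 L → ℕ := fun x => ((finFunctionFinEquiv (ofLex x) : Fin (L ^ 2)) : ℕ)
    with hrank
  set A : Finset (FermionTorus 2 L) := univ.filter fun x => rank x < m with hA_def
  set B : Finset (FermionTorus 2 L) :=
    (univ.filter fun x => rank x < 2 * m + 2 * L) \ (univ.filter fun x => rank x < m + 2 * L) with hB_def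
  have hAcard : A.card = m := by
    rw [hA_def, Theorems.hcf_card_filter_rank_lt]
    exact min_eq_right (by omega)
  have hBcard : B.card = m := by
    rw [hB_def, card_sdiff_of_subset (fun x hx => by
      simp only [mem_filter, mem_univ, true_and] at hx ⊢; omega),
      Theorems.hcf_card_filter_rank_lt, Theorems.hcf_card_filter_rank_lt, min_eq_right (by omega),
      min_eq_right (by omega)]
    omega
  have hmemB : ∀ y, y ∈ B ↔ m + 2 * L ≤ rank y ∧ rank y < 2 * m + 2 * L := fun y => by
    rw [hB_def, Finset.mem_sdiff, Finset.mem_filter, Finset.mem_filter]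
    simp only [Finset.mem_univ, true_and, not_lt]
    tauto
  refine ⟨Pi.single (pairSet A B) 1, Theorems.hcf_single_pairSet_mem_szSector L A B hAcard hBcard,
    by simp, fun x => ?_⟩
  refine localPair_mulVec_single_eq_zero L dWaveFormFactor (pairSet A B) x fun e he => ?_
  have hPA : ∀ y : TorusSite 2 L, FermionTorus.ofTorusSite y ∈ A ↔ (y 0).val + L * (y 1).val < m := by
    intro y
    simp only [hA_def, mem_filter, mem_univ, true_and, hrank]
    rw [Theorems.hcf_rank_ofTorusSite]
  have hQB : ∀ y : TorusSite 2 L, FermionTorus.ofTorusSite y ∈ B ↔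
      m + 2 * L ≤ (y 0).val + L * (y 1).val ∧ (y 0).val + L * (y 1).val < 2 * m + 2 * L := by
    intro y
    rw [hmemB]
    simp only [hrank]
    rw [Theorems.hcf_rank_ofTorusSite]
  have hsep := Theorems.hcf_rowSeparated_no_neighbours L hL hm x e he
    (fun y => FermionTorus.ofTorusSite y ∈ A) (fun y => FermionTorus.ofTorusSite y ∈ B) hPA hQB
  rw [Theorems.hcf_orb_mem_pairSet_iff, Theorems.hcf_orb_mem_pairSet_iff,
    Theorems.hcf_orb_mem_pairSet_iff, Theorems.hcf_orb_mem_pairSet_iff]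
  simp only [Fin.isValue, true_and, zero_ne_one, one_ne_zero, false_and, or_false, false_or]
  exact hsep

/-- The route's pair number fits with two spare rows once `3 ≤ δ L`:
`2⌊(1-δ)L²/2⌋ + 3L ≤ L²`. [folklore] -/
theorem pairNumber_rows_le (L : ℕ) {δ : ℝ} (hδ1 : δ ≤ 1) (hδL : 3 ≤ δ * L) :
    2 * ⌊(1 - δ) * (L : ℝ) ^ 2 / 2⌋₊ + 3 * L ≤ L ^ 2 := by
  have h1 : ((⌊(1 - δ) * (L : ℝ) ^ 2 / 2⌋₊ : ℕ) : ℝ) ≤ (1 - δ) * (L : ℝ) ^ 2 / 2 := by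
    refine Nat.floor_le ?_
    have : 0 ≤ 1 - δ := by linarith
    positivity
  have hL : (0 : ℝ) ≤ L := Nat.cast_nonneg L
  have h2 : (2 * ⌊(1 - δ) * (L : ℝ) ^ 2 / 2⌋₊ + 3 * L : ℝ) ≤ (L : ℝ) ^ 2 := by nlinarith
  exact_mod_cast h2

/-- **At every `δ ∈ (0, 1/2)` and every even side with `3 ≤ δL` the route's sector contains a unit vector
with `T_R = 0` at all scales** (the local kernel state at the route's density). [folklore] -/
theorem exists_unit_sector_state_boxSum_eq_zero {δ : ℝ} (hδ : δ ∈ Set.Ioo (0:ℝ) (1 / 2))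
    (L : ℕ) [NeZero L] (hL : 2 ≤ L) (hδL : 3 ≤ δ * L) :
    ∃ φ : Fock (Orb (FermionTorus 2 L)),
      φ ∈ szSector (Λ := FermionTorus 2 L) (2 * ⌊(1 - δ) * (L : ℝ) ^ 2 / 2⌋₊) 0 ∧
        star φ ⬝ᵥ φ = 1 ∧ ∀ R : ℕ, (∑ x : TorusSite 2 L, ∑ y : TorusSite 2 L,
              (∏ i : Fin 2, max 0 (1 - |(((y i - x i).valMinAbs : ℤ) : ℝ)| / (R : ℝ))) *
                (star (localPair dWaveFormFactor L x *ᵥ φ) ⬝ᵥ (localPair dWaveFormFactor L y *ᵥ φ)).re) = 0 := by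
  obtain ⟨φ, hφS, hφ1, hφ0⟩ := exists_unit_localKernel_state L hL
    (pairNumber_rows_le L (by linarith [hδ.2]) hδL)
  exact ⟨φ, hφS, hφ1, fun R => boxSum_eq_zero_of_forall_localPair_eq_zero L R hφ0⟩

/-- A convenient large even side: `L = 2(L₀ + ⌈3/δ⌉₊ + 1)` is even, `≥ L₀`, `≥ 2`, nonzero and has
`3 ≤ δ L`. [folklore] -/
theorem exists_good_side (L₀ : ℕ) {δ : ℝ} (hδ : 0 < δ) :
    ∃ L : ℕ, L₀ ≤ L ∧ Even L ∧ 2 ≤ L ∧ 3 ≤ δ * L := by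
  refine ⟨2 * (L₀ + ⌈3 / δ⌉₊ + 1), by omega, ⟨L₀ + ⌈3 / δ⌉₊ + 1, by ring⟩, by omega, ?_⟩
  have hc : 3 / δ ≤ (⌈3 / δ⌉₊ : ℝ) := Nat.le_ceil _
  have h3 : 3 ≤ δ * (⌈3 / δ⌉₊ : ℝ) := by
    calc (3 : ℝ) = δ * (3 / δ) := by field_simp
      _ ≤ δ * (⌈3 / δ⌉₊ : ℝ) := by gcongr
  push_cast
  nlinarith [Nat.cast_nonneg (α := ℝ) L₀, Nat.cast_nonneg (α := ℝ) ⌈3 / δ⌉₊]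

/-! ### The ground-state clause is load-bearing -/

/-- **Any proof must use minimality**: the crux with "normalised ground state in the sector" WEAKENED
to "unit vector in the sector" (density and `S^z` kept, minimality dropped) is FALSE — at every
`(U, δ)`, every margin `m > 0` and every scale `R ≥ 1` the row-separated `↑/↓` occupation state of the
sector has `T_R = 0`. [folklore] -/
theorem false_without_groundState :
    ¬ (∃ U : ℝ, 0 < U ∧ ∃ δ ∈ Set.Ioo (0:ℝ) (1 / 2), ∃ m : ℝ, 0 < m ∧ ∀ R₀ : ℕ, ∃ R : ℕ, R₀ ≤ R ∧
        ∃ L₀ : ℕ, ∀ (L : ℕ) [NeZero L], L₀ ≤ L → Even L →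
          ∀ ψ : Fock (Orb (FermionTorus 2 L)), star ψ ⬝ᵥ ψ = 1 →
            ψ ∈ szSector (Λ := FermionTorus 2 L) (2 * ⌊(1 - δ) * (L : ℝ) ^ 2 / 2⌋₊) 0 →
              m * (R : ℝ) ^ 2 ≤ (∑ x : TorusSite 2 L, ∑ y : TorusSite 2 L,
                    (∏ i : Fin 2, max 0 (1 - |(((y i - x i).valMinAbs : ℤ) : ℝ)| / (R : ℝ))) *
                      (star (localPair dWaveFormFactor L x *ᵥ ψ) ⬝ᵥ (localPair dWaveFormFactor L y *ᵥ ψ)).re) / (L : ℝ) ^ 2) := by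
  rintro ⟨U, -, δ, hδ, m, hm, h⟩
  obtain ⟨R, hR, L₀, hL⟩ := h 1
  obtain ⟨L, hL₀, hEven, hL2, hδL⟩ := exists_good_side L₀ hδ.1
  haveI : NeZero L := ⟨by omega⟩
  obtain ⟨φ, hφS, hφ1, hφ0⟩ := exists_unit_sector_state_boxSum_eq_zero hδ L hL2 hδL
  have hbad := hL L hL₀ hEven φ hφ1 hφS
  rw [hφ0 R, zero_div] at hbad
  have hRpos : (1 : ℝ) ≤ R := by exact_mod_cast hR
  have hR2 : (1 : ℝ) ≤ (R : ℝ) ^ 2 := by nlinarith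
  have hmR : m ≤ m * (R : ℝ) ^ 2 := le_mul_of_one_le_right hm.le hR2
  linarith

/-! ### The normalisation clause is load-bearing -/

/-- **Any proof must carry the normalisation**: without `star ψ ⬝ᵥ ψ = 1` the crux is FALSE —
`IsGroundStateInSector` is homogeneous (`NoGo.isGroundStateInSector_smul`), sector ground states exist
at every side (`NoGo.exists_unit_groundStateInSector_hubbardTorus`), and `T_R(cψ₀) = |c|² T_R(ψ₀) → 0`
as `c → 0` while `m R² ≥ m > 0` for `R ≥ 1`. [folklore] -/
theorem false_without_normalisation :
    ¬ (∃ U : ℝ, 0 < U ∧ ∃ δ ∈ Set.Ioo (0:ℝ) (1 / 2), ∃ m : ℝ, 0 < m ∧ ∀ R₀ : ℕ, ∃ R : ℕ, R₀ ≤ R ∧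
        ∃ L₀ : ℕ, ∀ (L : ℕ) [NeZero L], L₀ ≤ L → Even L →
          ∀ ψ : Fock (Orb (FermionTorus 2 L)),
            IsGroundStateInSector (hubbardTorus 2 L 1 U) (2 * ⌊(1 - δ) * (L : ℝ) ^ 2 / 2⌋₊) 0 ψ →
              m * (R : ℝ) ^ 2 ≤ (∑ x : TorusSite 2 L, ∑ y : TorusSite 2 L,
                    (∏ i : Fin 2, max 0 (1 - |(((y i - x i).valMinAbs : ℤ) : ℝ)| / (R : ℝ))) *
                      (star (localPair dWaveFormFactor L x *ᵥ ψ) ⬝ᵥ (localPair dWaveFormFactor L y *ᵥ ψ)).re) / (L : ℝ) ^ 2) := by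
  rintro ⟨U, -, δ, hδ, m, hm, h⟩
  obtain ⟨R, hR, L₀, hL⟩ := h 1
  obtain ⟨L, hL₀, hEven, hL2, -⟩ := exists_good_side L₀ hδ.1
  haveI : NeZero L := ⟨by omega⟩
  have hδ' : (-1 : ℝ) ≤ δ := by linarith [hδ.1]
  obtain ⟨ψ₀, -, hgs⟩ :=
    Summit.HubbardSuperconductivity.NoGo.exists_unit_groundStateInSector_hubbardTorus L 1 U
      (Summit.HubbardSuperconductivity.NoGo.floor_pairNumber_le δ hδ' L)
  set t : ℝ := (∑ x : TorusSite 2 L, ∑ y : TorusSite 2 L,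
        (∏ i : Fin 2, max 0 (1 - |(((y i - x i).valMinAbs : ℤ) : ℝ)| / (R : ℝ))) *
          (star (localPair dWaveFormFactor L x *ᵥ ψ₀) ⬝ᵥ (localPair dWaveFormFactor L y *ᵥ ψ₀)).re) with ht
  have hRpos : (1 : ℝ) ≤ R := by exact_mod_cast hR
  have hLpos : (0 : ℝ) < L := by exact_mod_cast (show 0 < L by omega)
  have hmRL : 0 < m * (R : ℝ) ^ 2 * (L : ℝ) ^ 2 := by positivity
  have ht1 : 0 < |t| + 1 := by positivity
  set ε : ℝ := m * (R : ℝ) ^ 2 * (L : ℝ) ^ 2 / (2 * (|t| + 1)) with hε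
  have hεpos : 0 < ε := by positivity
  set c : ℂ := ((Real.sqrt ε : ℝ) : ℂ) with hc
  have hc0 : c ≠ 0 := by
    rw [hc, Ne, Complex.ofReal_eq_zero]
    exact (Real.sqrt_pos.2 hεpos).ne'
  have hnorm : ‖c‖ ^ 2 = ε := by
    rw [hc, Complex.norm_real, Real.norm_of_nonneg (Real.sqrt_nonneg _), Real.sq_sqrt hεpos.le]
  have hbad := hL L hL₀ hEven (c • ψ₀)
    (Summit.HubbardSuperconductivity.NoGo.isGroundStateInSector_smul _ _ _ hgs hc0)
  rw [boxSum_smul, hnorm, le_div_iff₀ (by positivity)] at hbad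
  have h1 : ε * t ≤ ε * |t| := mul_le_mul_of_nonneg_left (le_abs_self t) hεpos.le
  have h2 : ε * |t| < m * (R : ℝ) ^ 2 * (L : ℝ) ^ 2 := by
    rw [hε, div_mul_eq_mul_div, div_lt_iff₀ (by positivity)]
    have : m * (R : ℝ) ^ 2 * (L : ℝ) ^ 2 * |t| < m * (R : ℝ) ^ 2 * (L : ℝ) ^ 2 * (2 * (|t| + 1)) :=
      mul_lt_mul_of_pos_left (by linarith [abs_nonneg t]) hmRL
    linarith
  linarith

/-! ### The scale quantifier: `R₀ = 0` is vacuous -/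

/-- **The `R₀ = 0` instance of the crux is vacuous**: at scale `R = 0` the inequality
`m · 0² ≤ T_0(ψ)/L² = ‖Δ_d ψ‖²/L²` holds for EVERY vector `ψ` and every real `m`; the content of the crux
starts at `R₀ = 1`. [folklore] -/
theorem body_holds_at_scale_zero (L : ℕ) [NeZero L] (m : ℝ) (ψ : Fock (Orb (FermionTorus 2 L))) :
    m * ((0 : ℕ) : ℝ) ^ 2 ≤ (∑ x : TorusSite 2 L, ∑ y : TorusSite 2 L,
          (∏ i : Fin 2, max 0 (1 - |(((y i - x i).valMinAbs : ℤ) : ℝ)| / ((0 : ℕ) : ℝ))) *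
            (star (localPair dWaveFormFactor L x *ᵥ ψ) ⬝ᵥ (localPair dWaveFormFactor L y *ᵥ ψ)).re) / (L : ℝ) ^ 2 := by
  rw [boxSum_zero_eq, Nat.cast_zero, zero_pow two_ne_zero, mul_zero]
  refine div_nonneg ?_ (by positivity)
  exact (Complex.nonneg_iff.1 (dotProduct_star_self_nonneg _)).1

end Summit.HubbardSuperconductivity.HubbardSuperconductivity.Theorems.MesoscopicPairOrder.Negative

end
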